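import Literature.Topology.FourManifolds.StereographicInversion
import Literature.Topology.FourManifolds.ConnectedSumData
import Literature.Topology.FourManifolds.ClosedBall
import Summits.SmoothPoincare4.SmoothPoincare4.Theses.EuclideanOrigami

/-!
# The round model of an immersed fake ball (route EuclideanOrigami, item `RoundModel`)

On the round `S⁴ ⊆ ℝ⁵` there are a smooth embedding `e : ℝ⁴ → S⁴` and a map `F : S⁴ → ℝ⁴` which is a
local diffeomorphism at every point outside `e(B̊⁴)`, injective there, and whose crease `F ∘ e|S³`
is the unit round sphere; moreover the crease GERM is exactly the inversion `ι y = y/‖y‖²`: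
`F (e y) = ι y` for all `y ≠ 0`.  Construction: `e = σᵥ⁻¹`, the inverse of Mathlib's stereographic
chart `stereographic' 4 v` from the pole `v` (so `e 0 = -v`), and `F = ¼ L⁻¹ ∘ σ₋ᵥ`, the chart from
the antipode renormalised by Mathlib's factor `4` (projection onto the hyperplane through the centre)
and the transfer isometry `L = stereoTransfer (-v)` between Mathlib's two identifications `(±v)ᗮ ≃ ℝ⁴`;
the identity `σ₋ᵥ = 4 • L ∘ ι ∘ σᵥ` is the tree's
`Literature.Topology.FourManifolds.stereographic'_eq_four_smul_transfer_sphereInversion`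
(Hirsch, *Differential Topology*, §1.1; Lee, *Introduction to Smooth Manifolds*, Problem 1-7).

* `roundModel_collar` — the model with the collar identity `F ∘ e = ι` off `0`;
* `roundModel` — the route item `Summit.SmoothPoincare4.SmoothPoincare4.Theses.EuclideanOrigami.RoundModel`
  (stmt-SmoothPoincare4-7488) verbatim.
-/

noncomputable section

-- the prescribed namespace `Summit.<P>.<Sub>.…` duplicates `SmoothPoincare4` (P = Sub)
set_option linter.dupNamespace false

open scoped Manifold ContDiff Topology RealInnerProductSpace
open Set Function Metric Module
open Literature.Topology.FourManifolds

namespace Summit.SmoothPoincare4.SmoothPoincare4.Theorems.RoundModel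

/-- A chart of the maximal `C^∞` atlas is a local diffeomorphism at every point of its source
(copy of the tree's `Literature.Topology.FourManifolds.isLocalDiffeomorphAt_of_mem_maximalAtlas`,
`SweepFinal.lean`, restated to keep the imports light). -/
theorem isLocalDiffeomorphAt_of_mem_maximalAtlas {M : Type*} [TopologicalSpace M]
    [ChartedSpace (EuclideanSpace ℝ (Fin 4)) M] [IsManifold (𝓡 4) ∞ M] {c : OpenPartialHomeomorph M (EuclideanSpace ℝ (Fin 4))}
    (hc : c ∈ IsManifold.maximalAtlas (𝓡 4) ∞ M) {p : M} (hp : p ∈ c.source) :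
    IsLocalDiffeomorphAt (𝓡 4) (𝓡 4) ∞ c p := by
  let Φ : PartialDiffeomorph (𝓡 4) (𝓡 4) M (EuclideanSpace ℝ (Fin 4)) ∞ :=
    { toPartialEquiv := c.toPartialEquiv
      open_source := c.open_source
      open_target := c.open_target
      contMDiffOn_toFun := contMDiffOn_of_mem_maximalAtlas hc
      contMDiffOn_invFun := contMDiffOn_symm_of_mem_maximalAtlas hc }
  exact ⟨Φ, hp, fun _ _ => rfl⟩

/-- **The round model with inverted collar.** On the round `S⁴` there are a smooth embedding
`e : ℝ⁴ → S⁴` and `F : S⁴ → ℝ⁴`, a local diffeomorphism at every point outside `e(B̊⁴)` and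
injective there, with `F (e y) = y/‖y‖²` for all `y ≠ 0` (so the crease is the unit round sphere
and the crease GERM is the inversion): `e = σᵥ⁻¹`, `F = ¼ L⁻¹ ∘ σ₋ᵥ` (Hirsch 1976 §1.1: the
transition between the stereographic charts at antipodal poles is the inversion; Lee 2013,
Problem 1-7). -/
theorem roundModel_collar :
    ∃ (e : (EuclideanSpace ℝ (Fin 4)) → (Metric.sphere (0 : EuclideanSpace ℝ (Fin 5)) 1)) (F : (Metric.sphere (0 : EuclideanSpace ℝ (Fin 5)) 1) → (EuclideanSpace ℝ (Fin 4))),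
      Manifold.IsSmoothEmbedding (𝓡 4) (𝓡 4) ∞ e ∧
      (∀ x, x ∉ e '' Metric.ball (0 : (EuclideanSpace ℝ (Fin 4))) 1 → IsLocalDiffeomorphAt (𝓡 4) (𝓡 4) ∞ F x) ∧
      Set.InjOn F (e '' Metric.ball (0 : (EuclideanSpace ℝ (Fin 4))) 1)ᶜ ∧
      (∀ u : (EuclideanSpace ℝ (Fin 4)), ‖u‖ = 1 → dist (F (e u)) 0 = 1) ∧
      ∀ y : (EuclideanSpace ℝ (Fin 4)), y ≠ 0 → F (e y) = sphereInversion y := by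
  haveI : Fact (Module.finrank ℝ (EuclideanSpace ℝ (Fin (4 + 1))) = 4 + 1) :=
    Literature.Topology.FourManifolds.fact_finrank_euclideanSpace_succ 4
  -- the pole `v`, the two charts and the transfer isometry
  let v : (Metric.sphere (0 : EuclideanSpace ℝ (Fin 5)) 1) := ⟨EuclideanSpace.single 0 1, by simp⟩
  set σ : OpenPartialHomeomorph (Metric.sphere (0 : EuclideanSpace ℝ (Fin 5)) 1) (EuclideanSpace ℝ (Fin 4)) := stereographic' 4 v with hσ
  set τ : OpenPartialHomeomorph (Metric.sphere (0 : EuclideanSpace ℝ (Fin 5)) 1) (EuclideanSpace ℝ (Fin 4)) := stereographic' 4 (-v) with hτ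
  set L : (EuclideanSpace ℝ (Fin 4)) ≃ₗᵢ[ℝ] (EuclideanSpace ℝ (Fin 4)) := stereoTransfer (n := 4) (-v) with hL
  -- the renormalising linear automorphism `z ↦ ¼ L⁻¹ z` of `ℝ⁴`
  let Λ : (EuclideanSpace ℝ (Fin 4)) ≃L[ℝ] (EuclideanSpace ℝ (Fin 4)) :=
    L.symm.toContinuousLinearEquiv.trans (ContinuousLinearEquiv.smulLeft (Units.mk0 (4 : ℝ)⁻¹ (by norm_num)))
  have hΛ : ∀ z, Λ z = (4 : ℝ)⁻¹ • L.symm z := fun z => rfl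
  let e : (EuclideanSpace ℝ (Fin 4)) → (Metric.sphere (0 : EuclideanSpace ℝ (Fin 5)) 1) := σ.symm
  let F : (Metric.sphere (0 : EuclideanSpace ℝ (Fin 5)) 1) → (EuclideanSpace ℝ (Fin 4)) := fun x => Λ (τ x)
  have hσt : σ.target = univ := stereographic'_target v
  have hσs : σ.source = {v}ᶜ := stereographic'_source v
  have hτs : τ.source = {-v}ᶜ := stereographic'_source (-v)
  have he0 : e 0 = -v := stereographic'_symm_zero v
  have he_ne_v : ∀ y, e y ≠ v := fun y h => by
    have : e y ∈ σ.source := σ.map_target (by rw [hσt]; exact mem_univ _)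
    rw [hσs] at this
    exact this h
  have he_inj : Injective e := by
    intro y y' h
    have := congrArg σ h
    rwa [σ.right_inv (by rw [hσt]; exact mem_univ _),
      σ.right_inv (by rw [hσt]; exact mem_univ _)] at this
  have he_ne_negv : ∀ {y}, y ≠ 0 → e y ≠ -v := fun {y} hy h => hy (he_inj (h.trans he0.symm))
  -- the collar identity `F ∘ e = ι` off the origin
  have hcollar : ∀ y : (EuclideanSpace ℝ (Fin 4)), y ≠ 0 → F (e y) = sphereInversion y := by
    intro y hy
    have h1 : e y ≠ -v := he_ne_negv hy
    have h2 : e y ≠ -(-v) := by rw [neg_neg]; exact he_ne_v y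
    have key := stereographic'_eq_four_smul_transfer_sphereInversion (n := 4) (-v) (e y) h1 h2
    have h3 : stereographic' 4 (-(-v)) (e y) = y := by
      rw [neg_neg]
      exact σ.right_inv (by rw [hσt]; exact mem_univ _)
    rw [h3] at key
    show Λ (τ (e y)) = sphereInversion y
    rw [hΛ, hτ, key, ← hL, L.symm.map_smul, L.symm_apply_apply, smul_smul]
    norm_num
  refine ⟨e, F, ?_, ?_, ?_, ?_, hcollar⟩
  · -- `e = σᵥ⁻¹` is a smooth embedding
    exact isSmoothEmbedding_symm_of_target_eq_univ (stereographic'_mem_maximalAtlas v) hσt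
  · -- `F` is a local diffeomorphism off `-v = e 0`, in particular off `e(B̊⁴)`
    intro x hx
    have hxv : x ≠ -v := by
      rintro rfl
      exact hx ⟨0, by simp, he0⟩
    have hτx : IsLocalDiffeomorphAt (𝓡 4) (𝓡 4) ∞ τ x :=
      isLocalDiffeomorphAt_of_mem_maximalAtlas (stereographic'_mem_maximalAtlas (-v))
        (by rw [hτs]; exact hxv)
    exact hτx.comp (hg := Λ.toDiffeomorph.isLocalDiffeomorph (τ x))
  · -- `F` is injective on the complement of `e(B̊⁴)`
    have hFv : F v = 0 := by
      show Λ (τ v) = 0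
      rw [hτ, stereographic'_neg_apply_self, map_zero]
    have hrepr : ∀ x, x ∉ e '' Metric.ball (0 : (EuclideanSpace ℝ (Fin 4))) 1 → x ≠ v → ∃ y, y ≠ 0 ∧ e y = x := by
      intro x hx hxv
      refine ⟨σ x, fun h0 => hx ⟨σ x, by rw [h0]; simp, ?_⟩, ?_⟩ <;>
        exact σ.left_inv (by rw [hσs]; exact hxv)
    intro x hx x' hx' hFF
    by_cases hxv : x = v
    · by_cases hx'v : x' = v
      · rw [hxv, hx'v]
      · obtain ⟨y', hy'0, rfl⟩ := hrepr x' hx' hx'v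
        rw [hxv, hFv, hcollar y' hy'0, eq_comm, sphereInversion.eq_zero_iff] at hFF
        exact absurd hFF hy'0
    · obtain ⟨y, hy0, rfl⟩ := hrepr x hx hxv
      by_cases hx'v : x' = v
      · rw [hx'v, hFv, hcollar y hy0, sphereInversion.eq_zero_iff] at hFF
        exact absurd hFF hy0
      · obtain ⟨y', hy'0, rfl⟩ := hrepr x' hx' hx'v
        rw [hcollar y hy0, hcollar y' hy'0] at hFF
        rw [sphereInversion.injective hFF]
  · -- the crease is the unit round sphere
    intro u hu
    have hu0 : u ≠ 0 := by rintro rfl; simp at hu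
    rw [hcollar u hu0, dist_zero_right, sphereInversion.norm_apply, hu, inv_one]

/-- **Route EuclideanOrigami, item `RoundModel` (stmt-SmoothPoincare4-7488).** On the round `S⁴`
there are a smooth embedding `e : ℝ⁴ → S⁴` and `F : S⁴ → ℝ⁴`, a local diffeomorphism at every point
outside `e(B̊⁴)` and injective there, whose crease is the unit round sphere (from
`roundModel_collar`, forgetting the collar identity). -/
theorem roundModel : Summit.SmoothPoincare4.SmoothPoincare4.Theses.EuclideanOrigami.RoundModel := by
  obtain ⟨e, F, h1, h2, h3, h4, -⟩ := roundModel_collar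
  exact ⟨e, F, h1, h2, h3, h4⟩

end Summit.SmoothPoincare4.SmoothPoincare4.Theorems.RoundModel

end
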